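import Summits.NavierStokesRegularity.NavierStokesRegularity.Theorems.AdaptedFrequencyAdaptedFrequencyConvergesLimitTwo

/-!
# Syndetic returns of the adapted frequency to `2` in logarithmic time
(crux stmt-NavierStokesRegularity-10493 `AdaptedFrequency.AdaptedFrequencyConverges`; rung of line
`birkhoff-recurrent-hull`, lands `--supports stmt-NavierStokesRegularity-10493`)

Quantitative form of `…LimitTwo.mapClusterPt_two`.  Under the crux hypotheses there are a final
window `[t₂, T)` and a constant `L ≥ 0` (namely `L = log (C₁/c₀)`, the oscillation of the
logarithmic clock `log((T − t)² H(t))` allowed by the two-sided pinching `c₀ ≤ (T − t)² H ≤ C₁`)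
such that for every `δ > 0`:

* `frequency_excursion_window` — an excursion `|Λ − 2| ≥ δ` maintained on a whole late interval
  `[t, t']` costs `δ · log((T − t)/(T − t')) ≤ L`, i.e. lasts at most `L/δ` units of similarity
  time `s = −log(T − t)`;
* `frequency_returns_near_two` — consequently `Λ` RETURNS to the `δ`-neighbourhood of `2` inside
  every late window of logarithmic length `> L/δ` (returns to `2` are syndetic in `s`, with an
  explicit gap bound, uniformly in the blow-up only through `c₀, C₁`).

Mechanism: the one-sided clocks `log H + (2 ± δ) log(T − ·)` of `…LimitTwoCore` are monotone on an
interval where `Λ ≥ 2 + δ` (resp. `≤ 2 − δ`) (`logWindow_le_of_frequency_ge/le`), and an interval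
on which `|Λ − 2| ≥ δ` is one-sided by continuity of `Λ` (intermediate value theorem).  A
counterexample to the crux therefore oscillates about `2` with excursions of log-length `O(1/δ)`
— the breathing picture of a discretely self-similar profile, and nothing slower.
-/

noncomputable section

open scoped Topology
open Literature.Analysis.FluidPDE Set Filter MeasureTheory

set_option linter.dupNamespace false

namespace Summit.NavierStokesRegularity.NavierStokesRegularity.Theorems.AdaptedFrequencyConverges.LimitTwo

/-! ### Real-analysis core: log-length of a one-sided excursion -/

/-- Positivity of `H` on a lower-pinched window. -/
theorem pos_of_lowerPinching {H : ℝ → ℝ} {a T c₀ : ℝ} (hc₀ : 0 < c₀)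
    (hlow : ∀ s ∈ Ioo a T, c₀ ≤ (T - s) ^ 2 * H s) : ∀ s ∈ Ioo a T, 0 < H s := by
  intro s hs
  have h1 := hlow s hs
  have h2 : 0 < (T - s) ^ 2 := pow_pos (sub_pos.2 hs.2) 2
  by_contra hle
  push Not at hle
  have : (T - s) ^ 2 * H s ≤ 0 := mul_nonpos_of_nonneg_of_nonpos h2.le hle
  linarith

/-- **Log-length of an excursion above `2 + δ`.** If `H` is differentiable on `(a, T)` and
two-sided pinched there (`0 < c₀ ≤ (T − s)² H(s) ≤ C₁`), and its frequency satisfies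
`(T − s) H′/H ≥ 2 + δ` on a whole interval `[t, t'] ⊂ (a, T)`, then
`δ · log((T − t)/(T − t')) ≤ log(C₁/c₀)` (any real `δ`; informative for `δ > 0`). -/
theorem logWindow_le_of_frequency_ge {H : ℝ → ℝ} {a T δ c₀ C₁ t t' : ℝ}
    (hc₀ : 0 < c₀) (hH : DifferentiableOn ℝ H (Ioo a T))
    (hpinch : ∀ s ∈ Ioo a T, c₀ ≤ (T - s) ^ 2 * H s ∧ (T - s) ^ 2 * H s ≤ C₁)
    (hat : a < t) (htt' : t ≤ t') (ht'T : t' < T)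
    (hΛ : ∀ s ∈ Icc t t', 2 + δ ≤ (T - s) * deriv H s / H s) :
    δ * Real.log ((T - t) / (T - t')) ≤ Real.log (C₁ / c₀) := by
  have hpos : ∀ s ∈ Ioo a T, 0 < H s := pos_of_lowerPinching hc₀ fun s hs => (hpinch s hs).1
  have hsub : Icc t t' ⊆ Ioo a T := fun s hs => ⟨hat.trans_le hs.1, hs.2.trans_lt ht'T⟩
  set φ : ℝ → ℝ := fun σ => Real.log (H σ) + (2 + δ) * Real.log (T - σ) with hφ
  have hφs : ∀ s, φ s = Real.log (H s) + (2 + δ) * Real.log (T - s) := fun s => rfl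
  have hder : ∀ τ ∈ Ioo a T, HasDerivAt φ (deriv H τ / H τ - (2 + δ) / (T - τ)) τ :=
    fun τ hτ => hasDerivAt_logClock hH hpos hτ
  have hmono : MonotoneOn φ (Icc t t') := by
    refine monotoneOn_of_deriv_nonneg (convex_Icc t t')
      (fun τ hτ => (hder τ (hsub hτ)).continuousAt.continuousWithinAt) ?_ ?_
    · rw [interior_Icc]
      exact fun τ hτ => (hder τ (hsub (Ioo_subset_Icc_self hτ))).differentiableAt
        |>.differentiableWithinAt
    · rw [interior_Icc]
      intro τ hτ
      have hτ' : τ ∈ Ioo a T := hsub (Ioo_subset_Icc_self hτ)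
      rw [(hder τ hτ').deriv]
      have hTτ : 0 < T - τ := sub_pos.2 hτ'.2
      have h := hΛ τ (Ioo_subset_Icc_self hτ)
      rw [le_div_iff₀ (hpos τ hτ')] at h
      rw [sub_nonneg, div_le_div_iff₀ hTτ (hpos τ hτ')]
      linarith [h, mul_comm (T - τ) (deriv H τ)]
  have htmem : t ∈ Ioo a T := hsub (left_mem_Icc.2 htt')
  have ht'mem : t' ∈ Ioo a T := hsub (right_mem_Icc.2 htt')
  have hTt : 0 < T - t := sub_pos.2 htmem.2
  have hTt' : 0 < T - t' := sub_pos.2 ht'T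
  have hle : φ t ≤ φ t' := hmono (left_mem_Icc.2 htt') (right_mem_Icc.2 htt') htt'
  -- lower pinching at `t`, upper pinching at `t'`
  have h1 : Real.log c₀ ≤ Real.log ((T - t) ^ 2 * H t) :=
    Real.log_le_log hc₀ (hpinch t htmem).1
  have h2 : Real.log ((T - t') ^ 2 * H t') ≤ Real.log C₁ :=
    Real.log_le_log (mul_pos (pow_pos hTt' 2) (hpos t' ht'mem)) (hpinch t' ht'mem).2
  rw [log_sq_mul htmem.2 (hpos t htmem)] at h1
  rw [log_sq_mul ht'T (hpos t' ht'mem)] at h2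
  have hC₁ : 0 < C₁ :=
    lt_of_lt_of_le (mul_pos (pow_pos hTt' 2) (hpos t' ht'mem)) (hpinch t' ht'mem).2
  rw [Real.log_div hTt.ne' hTt'.ne', Real.log_div hC₁.ne' hc₀.ne']
  rw [hφs t, hφs t'] at hle
  nlinarith [hle, h1, h2]

/-- **Log-length of an excursion below `2 − δ`.** Same as `logWindow_le_of_frequency_ge` for
`(T − s) H′/H ≤ 2 − δ` on `[t, t']`: `δ · log((T − t)/(T − t')) ≤ log(C₁/c₀)`. -/
theorem logWindow_le_of_frequency_le {H : ℝ → ℝ} {a T δ c₀ C₁ t t' : ℝ}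
    (hc₀ : 0 < c₀) (hH : DifferentiableOn ℝ H (Ioo a T))
    (hpinch : ∀ s ∈ Ioo a T, c₀ ≤ (T - s) ^ 2 * H s ∧ (T - s) ^ 2 * H s ≤ C₁)
    (hat : a < t) (htt' : t ≤ t') (ht'T : t' < T)
    (hΛ : ∀ s ∈ Icc t t', (T - s) * deriv H s / H s ≤ 2 - δ) :
    δ * Real.log ((T - t) / (T - t')) ≤ Real.log (C₁ / c₀) := by
  have hpos : ∀ s ∈ Ioo a T, 0 < H s := pos_of_lowerPinching hc₀ fun s hs => (hpinch s hs).1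
  have hsub : Icc t t' ⊆ Ioo a T := fun s hs => ⟨hat.trans_le hs.1, hs.2.trans_lt ht'T⟩
  set ψ : ℝ → ℝ := fun σ => Real.log (H σ) + (2 - δ) * Real.log (T - σ) with hψ
  have hψs : ∀ s, ψ s = Real.log (H s) + (2 - δ) * Real.log (T - s) := fun s => rfl
  have hder : ∀ τ ∈ Ioo a T, HasDerivAt ψ (deriv H τ / H τ - (2 - δ) / (T - τ)) τ :=
    fun τ hτ => hasDerivAt_logClock hH hpos hτ
  have hanti : AntitoneOn ψ (Icc t t') := by
    refine antitoneOn_of_deriv_nonpos (convex_Icc t t')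
      (fun τ hτ => (hder τ (hsub hτ)).continuousAt.continuousWithinAt) ?_ ?_
    · rw [interior_Icc]
      exact fun τ hτ => (hder τ (hsub (Ioo_subset_Icc_self hτ))).differentiableAt
        |>.differentiableWithinAt
    · rw [interior_Icc]
      intro τ hτ
      have hτ' : τ ∈ Ioo a T := hsub (Ioo_subset_Icc_self hτ)
      rw [(hder τ hτ').deriv]
      have hTτ : 0 < T - τ := sub_pos.2 hτ'.2
      have h := hΛ τ (Ioo_subset_Icc_self hτ)
      rw [div_le_iff₀ (hpos τ hτ')] at h
      rw [sub_nonpos, div_le_div_iff₀ (hpos τ hτ') hTτ]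
      linarith [h, mul_comm (T - τ) (deriv H τ)]
  have htmem : t ∈ Ioo a T := hsub (left_mem_Icc.2 htt')
  have ht'mem : t' ∈ Ioo a T := hsub (right_mem_Icc.2 htt')
  have hTt : 0 < T - t := sub_pos.2 htmem.2
  have hTt' : 0 < T - t' := sub_pos.2 ht'T
  have hle : ψ t' ≤ ψ t := hanti (left_mem_Icc.2 htt') (right_mem_Icc.2 htt') htt'
  -- upper pinching at `t`, lower pinching at `t'`
  have h1 : Real.log ((T - t) ^ 2 * H t) ≤ Real.log C₁ :=
    Real.log_le_log (mul_pos (pow_pos hTt 2) (hpos t htmem)) (hpinch t htmem).2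
  have h2 : Real.log c₀ ≤ Real.log ((T - t') ^ 2 * H t') :=
    Real.log_le_log hc₀ (hpinch t' ht'mem).1
  rw [log_sq_mul htmem.2 (hpos t htmem)] at h1
  rw [log_sq_mul ht'T (hpos t' ht'mem)] at h2
  have hC₁ : 0 < C₁ :=
    lt_of_lt_of_le (mul_pos (pow_pos hTt 2) (hpos t htmem)) (hpinch t htmem).2
  rw [Real.log_div hTt.ne' hTt'.ne', Real.log_div hC₁.ne' hc₀.ne']
  rw [hψs t, hψs t'] at hle
  nlinarith [hle, h1, h2]

/-- **Log-length of a two-sided excursion `|Λ − 2| ≥ δ`** when moreover `H` is `C²` (so that the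
frequency is continuous and the excursion is one-sided by the intermediate value theorem). -/
theorem logWindow_le_of_abs_frequency_ge {H : ℝ → ℝ} {a T δ c₀ C₁ t t' : ℝ} (hδ : 0 < δ)
    (hc₀ : 0 < c₀) (hC2 : ContDiffOn ℝ 2 H (Ioo a T))
    (hpinch : ∀ s ∈ Ioo a T, c₀ ≤ (T - s) ^ 2 * H s ∧ (T - s) ^ 2 * H s ≤ C₁)
    (hat : a < t) (htt' : t ≤ t') (ht'T : t' < T)
    (hΛ : ∀ s ∈ Icc t t', δ ≤ |(T - s) * deriv H s / H s - 2|) :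
    δ * Real.log ((T - t) / (T - t')) ≤ Real.log (C₁ / c₀) := by
  have hpos : ∀ s ∈ Ioo a T, 0 < H s := pos_of_lowerPinching hc₀ fun s hs => (hpinch s hs).1
  have hsub : Icc t t' ⊆ Ioo a T := fun s hs => ⟨hat.trans_le hs.1, hs.2.trans_lt ht'T⟩
  have hH : DifferentiableOn ℝ H (Ioo a T) := hC2.differentiableOn (by norm_num)
  have hcont : ContinuousOn (fun s => (T - s) * deriv H s / H s) (Icc t t') :=
    (continuousOn_frequency hC2 hpos).mono hsub
  -- the excursion is one-sided
  have hdich : (∀ s ∈ Icc t t', 2 + δ ≤ (T - s) * deriv H s / H s) ∨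
      (∀ s ∈ Icc t t', (T - s) * deriv H s / H s ≤ 2 - δ) := by
    by_contra hcon
    push Not at hcon
    obtain ⟨⟨s₁, hs₁, h1⟩, ⟨s₂, hs₂, h2⟩⟩ := hcon
    have h1' : (T - s₁) * deriv H s₁ / H s₁ ≤ 2 - δ := by
      rcases le_abs.1 (hΛ s₁ hs₁) with h | h
      · linarith
      · linarith
    have h2' : 2 + δ ≤ (T - s₂) * deriv H s₂ / H s₂ := by
      rcases le_abs.1 (hΛ s₂ hs₂) with h | h
      · linarith
      · linarith
    have hmem : (2 : ℝ) ∈ (fun s => (T - s) * deriv H s / H s) '' Icc t t' :=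
      isPreconnected_Icc.intermediate_value hs₁ hs₂ hcont ⟨by linarith, by linarith⟩
    obtain ⟨s, hs, hΛs⟩ := hmem
    have := hΛ s hs
    simp only at hΛs
    rw [hΛs, sub_self, abs_zero] at this
    linarith
  rcases hdich with hge | hle
  · exact logWindow_le_of_frequency_ge hc₀ hH hpinch hat htt' ht'T hge
  · exact logWindow_le_of_frequency_le hc₀ hH hpinch hat htt' ht'T hle

/-! ### The rung: excursion bound and syndetic returns for the adapted frequency -/

/-- **Excursion bound.** Under the crux hypotheses there are a final window `[t₂, T)` and
`L ≥ 0` such that for every `δ > 0` and every late interval `[t, t']` on which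
`|Λ − 2| ≥ δ` throughout, `δ · log((T − t)/(T − t')) ≤ L`: an excursion of the adapted
frequency away from `2` lasts at most `L/δ` units of similarity time `s = −log(T − t)`. -/
theorem frequency_excursion_window {ν T t₀ : ℝ}
    {u : ℝ → EuclideanSpace ℝ (Fin 3) → EuclideanSpace ℝ (Fin 3)}
    {p : ℝ → EuclideanSpace ℝ (Fin 3) → ℝ} {x₀ : EuclideanSpace ℝ (Fin 3)}
    {G : ℝ → EuclideanSpace ℝ (Fin 3) → ℝ} (hν : 0 < ν) (hT : 0 < T)
    (hcl : IsClassicalNSSolutionOn (Ico 0 T) ν 0 u p) (hLH : IsLerayHopfOn T ν 0 (u 0) u)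
    (hdec : HasRapidSpatialDecay (u 0)) (hTI : IsTypeIBlowup u T) (ht₀ : t₀ ∈ Ico 0 T)
    (hsing : ∀ r : ℝ, 0 < r →
      eLpNorm (Function.uncurry u) ⊤ (volume.restrict (parabolicCylinder r (T, x₀))) = ⊤)
    (hker : IsAdaptedBackwardKernel ν u (Ico t₀ T) T x₀ G)
    (hcmp : IsGaussianComparable G (Ico t₀ T) T x₀) :
    ∃ t₂ ∈ Ico t₀ T, ∃ L : ℝ, 0 ≤ L ∧ ∀ δ : ℝ, 0 < δ → ∀ t t' : ℝ, t₂ < t → t ≤ t' → t' < T →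
      (∀ s ∈ Icc t t', δ ≤ |adaptedFrequency u G T s - 2|) →
      δ * Real.log ((T - t) / (T - t')) ≤ L := by
  obtain ⟨a, c₀, C₁, ht₀a, haT, hc₀, hC2, hpinch⟩ :=
    pinchedWindow hν hT hcl hLH hdec hTI ht₀ hsing hker hcmp
  -- `L = log (C₁/c₀) ≥ 0`
  have hm : (a + T) / 2 ∈ Ioo a T := ⟨by linarith, by linarith⟩
  have hcC : c₀ ≤ C₁ := (hpinch _ hm).1.trans (hpinch _ hm).2
  have hL : 0 ≤ Real.log (C₁ / c₀) := Real.log_nonneg ((one_le_div hc₀).2 hcC)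
  refine ⟨a, ⟨ht₀a, haT⟩, Real.log (C₁ / c₀), hL, fun δ hδ t t' hat htt' ht'T hfar => ?_⟩
  exact logWindow_le_of_abs_frequency_ge hδ hc₀ hC2 hpinch hat htt' ht'T fun s hs => hfar s hs

/-- **Syndetic returns to `2`.** Under the crux hypotheses there are a final window `[t₂, T)`
and `L ≥ 0` such that for every `δ > 0`, every late interval `[t, t']` of logarithmic length
`log((T − t)/(T − t')) > L/δ` contains a time `s` with `|Λ(s) − 2| < δ`: the adapted frequency
returns to every neighbourhood of `2` with bounded gaps in similarity time. -/
theorem frequency_returns_near_two {ν T t₀ : ℝ}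
    {u : ℝ → EuclideanSpace ℝ (Fin 3) → EuclideanSpace ℝ (Fin 3)}
    {p : ℝ → EuclideanSpace ℝ (Fin 3) → ℝ} {x₀ : EuclideanSpace ℝ (Fin 3)}
    {G : ℝ → EuclideanSpace ℝ (Fin 3) → ℝ} (hν : 0 < ν) (hT : 0 < T)
    (hcl : IsClassicalNSSolutionOn (Ico 0 T) ν 0 u p) (hLH : IsLerayHopfOn T ν 0 (u 0) u)
    (hdec : HasRapidSpatialDecay (u 0)) (hTI : IsTypeIBlowup u T) (ht₀ : t₀ ∈ Ico 0 T)
    (hsing : ∀ r : ℝ, 0 < r →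
      eLpNorm (Function.uncurry u) ⊤ (volume.restrict (parabolicCylinder r (T, x₀))) = ⊤)
    (hker : IsAdaptedBackwardKernel ν u (Ico t₀ T) T x₀ G)
    (hcmp : IsGaussianComparable G (Ico t₀ T) T x₀) :
    ∃ t₂ ∈ Ico t₀ T, ∃ L : ℝ, 0 ≤ L ∧ ∀ δ : ℝ, 0 < δ → ∀ t t' : ℝ, t₂ < t → t ≤ t' → t' < T →
      L < δ * Real.log ((T - t) / (T - t')) →
      ∃ s ∈ Icc t t', |adaptedFrequency u G T s - 2| < δ := by
  obtain ⟨t₂, ht₂, L, hL, hexc⟩ :=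
    frequency_excursion_window hν hT hcl hLH hdec hTI ht₀ hsing hker hcmp
  refine ⟨t₂, ht₂, L, hL, fun δ hδ t t' h2t htt' ht'T hlong => ?_⟩
  by_contra hno
  push Not at hno
  have := hexc δ hδ t t' h2t htt' ht'T fun s hs => hno s hs
  linarith


end Summit.NavierStokesRegularity.NavierStokesRegularity.Theorems.AdaptedFrequencyConverges.LimitTwo

end
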